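import Literature.Topology.FourManifolds.Knots
import Literature.Topology.FourManifolds.IsotopyProofs
import HarnessLib

/-!
# Isotopy of knots and links is an equivalence relation: discharge of the `IsotopyFacts`

Sibling proof file of `Knots.lean` (D-0014: named facts `def X : Prop` are discharged as
`theorem X_holds : X`). The isotopy facts of `Knots.lean` whose proofs were deferred are special
cases of the ambient-isotopy facts of `Isotopy.lean`, discharged in `Isotopy.lean` /
`IsotopyProofs.lean` (`Literature.Topology.FourManifolds.IsAmbientIsotopic.symm_holds`: reversed ambient isotopy
`t ↦ F (1 - t) ∘ (F 1)⁻¹`; `Literature.Topology.FourManifolds.IsAmbientIsotopic.trans_holds`: stagewise composition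
`AmbientIsotopy.comp`; `Literature.Topology.FourManifolds.IsAmbientIsotopic.isSmoothlyIsotopic_holds`). This file records the
specialisations:

* `Literature.Topology.FourManifolds.SphereEmbedding.IsIsotopic.symm_holds`, `Literature.Topology.FourManifolds.SphereEmbedding.IsIsotopic.trans_holds`,
  the instance `Literature.SphereEmbedding.isotopyFacts : SphereEmbedding.IsotopyFacts k n` (so every
  `[SphereEmbedding.IsotopyFacts k n]` binder of the tree — `equivalence_isIsotopic`,
  `KnotClass.mk_eq_mk_iff`, the connected-sum lemmas of `BandSum.lean` — is dischargeable by
  `inferInstance`), and `Literature.Topology.FourManifolds.SphereEmbedding.IsIsotopic.isSmoothlyIsotopic_holds`;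
* `Literature.Topology.FourManifolds.Link.IsIsotopic.trans_holds` (one ambient isotopy for all components at once: the
  stagewise composition `F.comp G` has end stage `G 1 ∘ F 1`) and the instance
  `Literature.Link.isotopyFacts : Link.IsotopyFacts ι` (symmetry is `Link.IsIsotopic.symm_holds` of
  `Knots.lean`), discharging the `[Link.IsotopyFacts ι]` binders of `KirbyMoves.lean`
  (`FramedLink.IsIsotopic.symm/.trans`, `FramedLink.equivalence_isIsotopic`).

Source: M. W. Hirsch, *Differential Topology* (1976), Ch. 8 §1, p. 178 (isotopy and ambient
isotopy are equivalence relations). [cite: Hirsch1976, §8.1]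
-/

open scoped Manifold ContDiff Topology
open Function Set

noncomputable section

namespace Literature.Topology.FourManifolds

namespace SphereEmbedding

variable {k n : ℕ}

/-- Discharge of `SphereEmbedding.IsIsotopic.symm` (`Knots.lean`): isotopy of sphere embeddings
is symmetric (reversed ambient isotopy, `IsAmbientIsotopic.symm_holds`). Hirsch (1976), §8.1,
p. 178. [cite: Hirsch1976, §8.1] -/
theorem IsIsotopic.symm_holds : IsIsotopic.symm (k := k) (n := n) :=
  fun h ↦ IsAmbientIsotopic.symm_holds h

/-- Discharge of `SphereEmbedding.IsIsotopic.trans` (`Knots.lean`): isotopy of sphere embeddings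
is transitive (stagewise composition of ambient isotopies, `IsAmbientIsotopic.trans_holds`).
Hirsch (1976), §8.1, p. 178. [cite: Hirsch1976, §8.1] -/
theorem IsIsotopic.trans_holds : IsIsotopic.trans (k := k) (n := n) :=
  fun h h' ↦ IsAmbientIsotopic.trans_holds h h'

/-- **All deferred isotopy facts of sphere embeddings hold**: the fact bundle
`SphereEmbedding.IsotopyFacts k n` (symmetry and transitivity of ambient isotopy of sphere
embeddings `𝕊 k → 𝕊 n`) is inhabited, so knot types (`KnotClass.mk_eq_mk_iff`) and the
connected-sum congruence lemmas are available unconditionally once this file is imported.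
Hirsch (1976), §8.1. [cite: Hirsch1976, §8.1] -/
instance isotopyFacts : IsotopyFacts k n :=
  ⟨IsIsotopic.symm_holds, IsIsotopic.trans_holds⟩

/-- Discharge of `SphereEmbedding.IsIsotopic.isSmoothlyIsotopic` (`Knots.lean`): isotopic sphere
embeddings are smoothly isotopic as maps (`t ↦ F t ∘ K`, `IsAmbientIsotopic.isSmoothlyIsotopic_holds`
with the smooth embedding `K`). Hirsch (1976), §8.1. [cite: Hirsch1976, §8.1] -/
theorem IsIsotopic.isSmoothlyIsotopic_holds : IsIsotopic.isSmoothlyIsotopic (k := k) (n := n) :=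
  fun {K _} h ↦ IsAmbientIsotopic.isSmoothlyIsotopic_holds K.isSmoothEmbedding h

end SphereEmbedding

namespace Link

variable {ι : Type*}

/-- Discharge of `Link.IsIsotopic.trans` (`Knots.lean`): isotopy of links is transitive — if
`F 1 ∘ Lᵢ = L'ᵢ` and `G 1 ∘ L'ᵢ = L''ᵢ` for all components `i`, then the stagewise composition
`F.comp G` (`IsotopyProofs.lean`; end stage `G 1 ∘ F 1`) is one ambient isotopy of `S³` with
`(F.comp G) 1 ∘ Lᵢ = L''ᵢ` for all `i`. Hirsch (1976), §8.1, p. 178. [cite: Hirsch1976, §8.1] -/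
theorem IsIsotopic.trans_holds : IsIsotopic.trans (ι := ι) := by
  rintro L L' L'' ⟨F, hF⟩ ⟨G, hG⟩
  exact ⟨F.comp G, fun i ↦ by rw [AmbientIsotopy.comp_toFun, comp_assoc, hF i, hG i]⟩

/-- **All deferred isotopy facts of links hold**: the fact bundle `Link.IsotopyFacts ι`
(symmetry — `Link.IsIsotopic.symm_holds` of `Knots.lean` — and transitivity of isotopy of links)
is inhabited, so `FramedLink.IsIsotopic.symm/.trans` and `FramedLink.equivalence_isIsotopic`
(`KirbyMoves.lean`) are available unconditionally once this file is imported. Hirsch (1976), §8.1.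
[cite: Hirsch1976, §8.1] -/
instance isotopyFacts : IsotopyFacts ι :=
  ⟨IsIsotopic.symm_holds, IsIsotopic.trans_holds⟩

end Link

end Literature.Topology.FourManifolds
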